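import Summits.CriticalPhenomena.CardyFormulaZ2.Theorems.CardyIKTransportRenewalGridHarmlessBulge
import Summits.CriticalPhenomena.CardyFormulaZ2.Theorems.CardyIKTransportRenewalGridHarmlessDualBlock2
import Summits.CriticalPhenomena.CardyFormulaZ2.Theorems.CardyIKTransportRenewalGridHarmlessModuli
import Summits.CriticalPhenomena.CardyFormulaZ2.Theorems.CardyIKTransportRenewalGridHarmlessTemplates
import Summits.CriticalPhenomena.CardyFormulaZ2.Theorems.CardyIKTransportRenewalGridHarmlessDistortion
import Literature.Probability.Percolation.CornerPercolation
import Literature.Probability.RandomPlanarGeometry.CardyFunctionIncBeta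

/-!
# `RenewalGridHarmless` holds (route `CardyIKTransport`, item stmt-CriticalPhenomena-4967)

`theorem renewalGridHarmless_proof : CardyIKTransport.RenewalGridHarmless` — bond percolation on
`ℤ²` at `p = ½` drawn on ANY asymptotically homogeneous isotropic product grid
`z v = (s v₀, t v₁)` (`s i / i → a`, `t i / i → a` two-sidedly, `a > 0`) has Cardy limits for the
crude embedded crossing event `embDomainCrossing` in every conformal rectangle ONLY IF the standard
embedding `squareLatticeEmbedding.z` does: `(∀ R, Cardy via z_{s,t}) → (∀ R, Cardy via z)`.

Proof: an INCLUSION SANDWICH through Schoenflies square models, with no percolation estimate beyond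
the exact self-duality of `P_{1/2}`. Fix `R` with square model `Φ` (`exists_isSquareModel`).
* Lower bound (`exists_measureReal_hyp_le`): a Hyp-crossing of the BULGED template
  `Q⁺_ε = Φ([-1+ε,1-ε] × [-1-ε,1+ε])` at mesh `δ√2/a`, whose true standard positions are an
  `o(1)` distortion of its hypothesis positions (`exists_delta_norm_sub_le`), starts beyond
  `R.arc 0` and ends beyond `R.arc 2`, so it contains a crude crossing of `R` at mesh `δ`
  (`exists_subchain_crossing`; the slack of the crude event plays no role).
* Upper bound (`exists_measureReal_std_le`): a crude crossing of `R` and a DUAL-open Hyp-crossing of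
  the CONJUGATE bulged template `Q†_ε = (Φ∘ρ)(…)` (arc `0` = beyond `R.arc 1`) cannot coexist
  (`false_of_crossing_of_dualChain`), and the dual event has the Hyp probability
  (`bondPercolation_map_dualConfig_holds`).
* Limits: by hypothesis the two template probabilities tend to `F(η(Q⁺_ε))`, `F(η(Q†_ε))`; as
  `ε → 0` these moduli tend to `η(R)` and `1 - η(R)` (Radó continuity
  `tendsto_crossRatio_perturbQuad`, same carrier/marks `crossRatio_eq_of_carrier_eq_of_pt_eq`,
  conjugate marking `crossRatio_eq_one_sub_of_pt_eq_succ`), and `F(1-η) = 1 - F(η)`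
  (`cardyFunction_one_sub_holds`), `F` continuous on `(0,1)`.
The monotonicity hypotheses on `s, t` are not used (the companion file `…Gap.lean` shows the
antecedent is in fact void whenever `t` has gaps `> 2` at arbitrarily large heights, e.g. `a > 2`).

References: O. Schramm, S. Smirnov, Ann. Probab. 39 (2011) §1.3, §5 (perturbed quads and their
partial order); B. Bollobás, O. Riordan, *Percolation* (2006) Ch. 7 (boundary sandwich);
V. Beffara, arXiv:0708.3908 Prop. 4 (conjugate marking); G. Grimmett, I. Manolescu, PTRF 159 (2014)
§2.2 (embedded crossing events); Ch. Pommerenke (1992) §2.3 (Radó).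
-/

noncomputable section

namespace Summit.CriticalPhenomena.CardyFormulaZ2.Theorems.CardyIKTransport.RenewalGridHarmless

open Filter Set Metric MeasureTheory Complex
open scoped Topology
open UpperHalfPlane (upperHalfPlaneSet)
open Literature.Probability.Percolation hiding cardyFunction
open Literature.Probability.LatticeModels
open Literature.Probability.RandomPlanarGeometry
open Literature.Topology.PlaneTopology

/-! ### The two inclusions, in probability -/

section Sandwich

variable {a : ℝ} {s t : ℤ → ℝ} (ha : 0 < a)
  (hsa : Tendsto (fun i : ℤ => s i / (i : ℝ)) (cocompact ℤ) (𝓝 a))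
  (hta : Tendsto (fun i : ℤ => t i / (i : ℝ)) (cocompact ℤ) (𝓝 a))
  {R : ConformalRectangle} {Φ : ℂ ≃ₜ ℂ} (hΦ : IsSquareModel R Φ)
include ha hsa hta hΦ

/-- **Lower inclusion in probability.** For the bulged template `Q⁺_ε` (`0 < ε ≤ 1/2`) and all small
meshes `δ`: `P(Hyp-crossing of Q⁺_ε at mesh δ√2/a) ≤ P(crude crossing of R at mesh δ)`
(`exists_subchain_crossing` with the distortion control `exists_delta_norm_sub_le`). [folklore] -/
theorem exists_measureReal_hyp_le {ε : ℝ} (hε0 : 0 < ε) (hε : ε ≤ 1 / 2) :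
    ∃ δ₀ > 0, ∀ δ : ℝ, 0 < δ → δ < δ₀ →
      (bondPercolation (zdGraph 2) half).real (embDomainCrossing
        (fun v : Site 2 ↦ (⟨s (v 0), t (v 1)⟩ : ℂ))
        (perturbQuad Φ (-1 + ε) (1 - ε) (-1 - ε) (1 + ε) (by linarith) (by linarith)).carrier
        (δ * Real.sqrt 2 / a)
        ((perturbQuad Φ (-1 + ε) (1 - ε) (-1 - ε) (1 + ε) (by linarith) (by linarith)).arc 0)
        ((perturbQuad Φ (-1 + ε) (1 - ε) (-1 - ε) (1 + ε) (by linarith) (by linarith)).arc 2)) ≤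
      (bondPercolation (zdGraph 2) half).real (embDomainCrossing squareLatticeEmbedding.z
        R.carrier δ (R.arc 0) (R.arc 2)) := by
  set Q := perturbQuad Φ (-1 + ε) (1 - ε) (-1 - ε) (1 + ε) (by linarith) (by linarith) with hQ
  obtain ⟨hs1, hs2⟩ := one_le_sqrt_two_and
  -- room of the chart at precision `ν = ε/4`
  have hν : 0 < ε / 4 := by positivity
  obtain ⟨ρ, hρ, hroom⟩ := exists_chart_room Φ isCompact_modelBox hν
  -- a bounded window containing the closed template
  obtain ⟨C₀, hC₀⟩ := ((Q.isBounded.closure)).subset_closedBall (0 : ℂ)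
  set C : ℝ := max C₀ 1 with hC
  have hCpos : 0 < C := lt_of_lt_of_le one_pos (le_max_right _ _)
  -- distortion control at precision `ρ/2`
  obtain ⟨δ₁, hδ₁, hdist⟩ := exists_delta_norm_sub_le ha hsa hta hCpos (half_pos hρ)
  refine ⟨min (min (δ₁ * a / 2) (ρ * a / 8)) (ρ / 8), by positivity, fun δ hδ hδlt => ?_⟩
  have hδ1 : δ < δ₁ * a / 2 := hδlt.trans_le ((min_le_left _ _).trans (min_le_left _ _))
  have hδ2 : δ < ρ * a / 8 := hδlt.trans_le ((min_le_left _ _).trans (min_le_right _ _))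
  have hδ3 : δ < ρ / 8 := hδlt.trans_le (min_le_right _ _)
  set δ' : ℝ := δ * Real.sqrt 2 / a with hδ'
  have hδ'pos : 0 < δ' := div_pos (mul_pos hδ (by linarith)) ha
  have hδ'lt : δ' < δ₁ := by
    rw [hδ', div_lt_iff₀ ha]; nlinarith
  have h2δ' : 2 * δ' ≤ ρ / 2 := by
    rw [hδ']
    have : 2 * (δ * Real.sqrt 2 / a) = (2 * δ * Real.sqrt 2) / a := by ring
    rw [this, div_le_iff₀ ha]; nlinarith
  have hedge : δ * Real.sqrt 2 ≤ ρ := by nlinarith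
  have hδ'a : δ' * a = δ * Real.sqrt 2 := by rw [hδ']; field_simp
  -- the inclusion, for lattice configurations
  refine measureReal_le_of_subset_lattice fun ω hω hH => ?_
  obtain ⟨u, hu, u', hu', hconn⟩ := mem_embDomainCrossing_iff.1 hH
  obtain ⟨n, w, hw0, hwn, hwS, hwopen⟩ := exists_chain_of_mem_openConnIn hconn
  have hwadj : ∀ k, k < n → (zdGraph 2).Adj (w k) (w (k + 1)) := fun k hk =>
    (SimpleGraph.mem_edgeSet _).1 (hω (hwopen k hk).1)
  -- norms of hypothesis positions
  have hnorm : ∀ k, ‖((δ' : ℝ) : ℂ) * (⟨s (w k 0), t (w k 1)⟩ : ℂ)‖ ≤ C := by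
    intro k
    have : ((δ' : ℝ) : ℂ) * (⟨s (w k 0), t (w k 1)⟩ : ℂ) ∈ closedBall (0 : ℂ) C₀ :=
      hC₀ (subset_closure (hwS k))
    rw [mem_closedBall, dist_zero_right] at this
    exact this.trans (le_max_left _ _)
  obtain ⟨i, j, -, -, hconn', hdi, hdj⟩ := exists_subchain_crossing hΦ (ε := ε) (ν := ε / 4)
    (ρ := ρ) (ρ' := δ * Real.sqrt 2) hν (by linarith) hε hroom hedge (by positivity)
    (ω := ω) (P := fun v => (δ : ℂ) * squareLatticeEmbedding.z v)
    (P' := fun v => ((δ' : ℝ) : ℂ) * (⟨s (v 0), t (v 1)⟩ : ℂ)) (n := n) (w := w)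
    hwopen
    (fun k hk => by rw [dist_mul_z_of_adj hδ.le (hwadj k hk)])
    (fun k _ => by
      rw [dist_comm, dist_eq_norm, mul_z_eq, ← hδ'a]
      exact hdist δ' hδ'pos hδ'lt (w k) (hnorm k))
    (fun k _ => (mem_closure_perturbQuad_carrier (by linarith) (by linarith) Φ).1
      (subset_closure (hwS k)))
    (by
      obtain ⟨y, hy, hyd⟩ := (Q.isCompact_arc 0).exists_infDist_eq_dist ⟨_, Q.pt_mem_arc_self 0⟩
        (((δ' : ℝ) : ℂ) * (⟨s (u 0), t (u 1)⟩ : ℂ))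
      obtain ⟨hyim, hyre⟩ := (mem_perturbQuad_arc_zero (by linarith) (by linarith) Φ).1 hy
      refine ⟨y, hyim, hyre, ?_⟩
      rw [hw0, ← hyd]; linarith)
    (by
      obtain ⟨y, hy, hyd⟩ := (Q.isCompact_arc 2).exists_infDist_eq_dist ⟨_, Q.pt_mem_arc_self 2⟩
        (((δ' : ℝ) : ℂ) * (⟨s (u' 0), t (u' 1)⟩ : ℂ))
      obtain ⟨hyim, hyre⟩ := (mem_perturbQuad_arc_two (by linarith) (by linarith) Φ).1 hy
      refine ⟨y, hyim, hyre, ?_⟩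
      rw [hwn, ← hyd]; linarith)
  have h2δ : δ * Real.sqrt 2 ≤ 2 * δ := by nlinarith
  exact mem_embDomainCrossing_iff.2 ⟨w i, hdi.trans h2δ, w j, hdj.trans h2δ, hconn'⟩

/-- **Upper inclusion in probability.** For the conjugate bulged template `Q†_ε` (`0 < ε ≤ 1/2`)
and all small meshes `δ`: `P(crude crossing of R at mesh δ) ≤ 1 - P(Hyp-crossing of Q†_ε at mesh
δ√2/a)` (self-duality `measureReal_preimage_dualConfig` and the blocking theorem
`false_of_crossing_of_dualChain`). [folklore] -/
theorem exists_measureReal_std_le {ε : ℝ} (hε0 : 0 < ε) (hε : ε ≤ 1 / 2) :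
    ∃ δ₀ > 0, ∀ δ : ℝ, 0 < δ → δ < δ₀ →
      (bondPercolation (zdGraph 2) half).real (embDomainCrossing squareLatticeEmbedding.z
        R.carrier δ (R.arc 0) (R.arc 2)) ≤
      1 - (bondPercolation (zdGraph 2) half).real (embDomainCrossing
        (fun v : Site 2 ↦ (⟨s (v 0), t (v 1)⟩ : ℂ))
        (perturbQuad ((Homeomorph.mulLeft₀ I I_ne_zero).trans Φ) (-1 + ε) (1 - ε) (-1 - ε)
          (1 + ε) (by linarith) (by linarith)).carrier
        (δ * Real.sqrt 2 / a)
        ((perturbQuad ((Homeomorph.mulLeft₀ I I_ne_zero).trans Φ) (-1 + ε) (1 - ε) (-1 - ε)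
          (1 + ε) (by linarith) (by linarith)).arc 0)
        ((perturbQuad ((Homeomorph.mulLeft₀ I I_ne_zero).trans Φ) (-1 + ε) (1 - ε) (-1 - ε)
          (1 + ε) (by linarith) (by linarith)).arc 2)) := by
  set Q := perturbQuad ((Homeomorph.mulLeft₀ I I_ne_zero).trans Φ) (-1 + ε) (1 - ε) (-1 - ε)
    (1 + ε) (by linarith) (by linarith) with hQ
  obtain ⟨hs1, hs2⟩ := one_le_sqrt_two_and
  have hν : 0 < ε / 4 := by positivity
  obtain ⟨ρ, hρ, hroom⟩ := exists_chart_room Φ isCompact_modelBox hν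
  obtain ⟨C₀, hC₀⟩ := ((Q.isBounded.closure)).subset_closedBall (0 : ℂ)
  set C : ℝ := max C₀ 1 with hC
  have hCpos : 0 < C := lt_of_lt_of_le one_pos (le_max_right _ _)
  have hρ4 : 0 < ρ / 4 := by positivity
  obtain ⟨δ₁, hδ₁, hdist⟩ := exists_delta_norm_sub_le ha hsa hta hCpos hρ4
  refine ⟨min (min (δ₁ * a / 2) (ρ * a / 8)) (ρ / 8), by positivity, fun δ hδ hδlt => ?_⟩
  have hδ1 : δ < δ₁ * a / 2 := hδlt.trans_le ((min_le_left _ _).trans (min_le_left _ _))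
  have hδ2 : δ < ρ * a / 8 := hδlt.trans_le ((min_le_left _ _).trans (min_le_right _ _))
  have hδ3 : δ < ρ / 8 := hδlt.trans_le (min_le_right _ _)
  set δ' : ℝ := δ * Real.sqrt 2 / a with hδ'
  have hδ'pos : 0 < δ' := div_pos (mul_pos hδ (by linarith)) ha
  have hδ'lt : δ' < δ₁ := by
    rw [hδ', div_lt_iff₀ ha]; nlinarith
  have h2δ' : 2 * δ' ≤ ρ / 2 := by
    rw [hδ']
    have : 2 * (δ * Real.sqrt 2 / a) = (2 * δ * Real.sqrt 2) / a := by ring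
    rw [this, div_le_iff₀ ha]; nlinarith
  have hδ'a : δ' * a = δ * Real.sqrt 2 := by rw [hδ']; field_simp
  -- self-duality: the Hyp event read on the dual configuration has the same probability
  have hmeas := measurableSet_embDomainCrossing (fun v : Site 2 ↦ (⟨s (v 0), t (v 1)⟩ : ℂ))
    Q.carrier δ' (Q.arc 0) (Q.arc 2)
  rw [← measureReal_preimage_dualConfig hmeas]
  refine measureReal_le_one_sub (hmeas.preimage measurable_dualConfig) fun ω hω hE hD => ?_
  have hD' : dualConfig ω ∈ embDomainCrossing (fun v : Site 2 ↦ (⟨s (v 0), t (v 1)⟩ : ℂ))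
    Q.carrier δ' (Q.arc 0) (Q.arc 2) := hD
  obtain ⟨u, hu, u', hu', hconn⟩ := mem_embDomainCrossing_iff.1 hD'
  obtain ⟨m, w, hw0, hwm, hwS, hwopen⟩ := exists_chain_of_mem_openConnIn hconn
  have hnorm : ∀ k, ‖((δ' : ℝ) : ℂ) * (⟨s (w k 0), t (w k 1)⟩ : ℂ)‖ ≤ C := by
    intro k
    have : ((δ' : ℝ) : ℂ) * (⟨s (w k 0), t (w k 1)⟩ : ℂ) ∈ closedBall (0 : ℂ) C₀ :=
      hC₀ (subset_closure (hwS k))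
    rw [mem_closedBall, dist_zero_right] at this
    exact this.trans (le_max_left _ _)
  refine false_of_crossing_of_dualChain hΦ (ε := ε) (ν := ε / 4) (ρ := ρ) (δ := δ) hν
    (by linarith) hε hroom hδ (by linarith) hω hE
    (P' := fun v => ((δ' : ℝ) : ℂ) * (⟨s (v 0), t (v 1)⟩ : ℂ)) (m := m) (w := w) hwopen
    (fun j _ => ?_) (fun j _ => symm_re_im_of_mem_closure_rotTemplate hε0 (by linarith)
      (subset_closure (hwS j))) ?_ ?_
  · calc dist ((δ : ℂ) * squareLatticeEmbedding.c (w j)) (((δ' : ℝ) : ℂ) * ⟨s (w j 0), t (w j 1)⟩)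
        ≤ dist ((δ : ℂ) * squareLatticeEmbedding.c (w j)) ((δ : ℂ) * squareLatticeEmbedding.z (w j))
          + dist ((δ : ℂ) * squareLatticeEmbedding.z (w j)) (((δ' : ℝ) : ℂ) * ⟨s (w j 0), t (w j 1)⟩) :=
          dist_triangle _ _ _
      _ ≤ δ + ρ / 4 := by
          refine add_le_add (le_of_eq (dist_mul_c_mul_z hδ.le (w j))) ?_
          rw [dist_comm, dist_eq_norm, mul_z_eq, ← hδ'a]
          exact hdist δ' hδ'pos hδ'lt (w j) (hnorm j)
      _ ≤ ρ / 2 := by linarith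
  · obtain ⟨y, hy, hyd⟩ := (Q.isCompact_arc 0).exists_infDist_eq_dist ⟨_, Q.pt_mem_arc_self 0⟩
      (((δ' : ℝ) : ℂ) * (⟨s (u 0), t (u 1)⟩ : ℂ))
    obtain ⟨hyre, hyim⟩ := symm_re_im_of_mem_arc_zero_rotTemplate hε0 (by linarith) hy
    refine ⟨y, hyre, hyim, ?_⟩
    rw [hw0, ← hyd]; linarith
  · obtain ⟨y, hy, hyd⟩ := (Q.isCompact_arc 2).exists_infDist_eq_dist ⟨_, Q.pt_mem_arc_self 2⟩
      (((δ' : ℝ) : ℂ) * (⟨s (u' 0), t (u' 1)⟩ : ℂ))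
    obtain ⟨hyre, hyim⟩ := symm_re_im_of_mem_arc_two_rotTemplate hε0 (by linarith) hy
    refine ⟨y, hyre, hyim, ?_⟩
    rw [hwm, ← hyd]; linarith

end Sandwich

/-! ### The theorem -/

/-- The vanishing sequence of bulge widths `ε_n = 1/(n+4) ∈ (0, 1/4]`. [folklore] -/
theorem bulgeSeq_facts :
    (∀ n : ℕ, (0 : ℝ) < 1 / ((n : ℝ) + 4)) ∧ (∀ n : ℕ, 1 / ((n : ℝ) + 4) ≤ (1 : ℝ) / 4) ∧
      Tendsto (fun n : ℕ => 1 / ((n : ℝ) + 4)) atTop (𝓝 0) := by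
  refine ⟨fun n => by positivity, fun n => ?_, ?_⟩
  · rw [div_le_div_iff_of_pos_left one_pos (by positivity) (by norm_num)]
    have : (0 : ℝ) ≤ n := n.cast_nonneg
    linarith
  · refine tendsto_of_tendsto_of_tendsto_of_le_of_le tendsto_const_nhds
      tendsto_one_div_add_atTop_nhds_zero_nat (fun n => by positivity) (fun n => ?_)
    exact div_le_div_of_nonneg_left zero_le_one (by positivity) (by linarith)

/-- **`RenewalGridHarmless` holds** (route `CardyIKTransport`, item stmt-CriticalPhenomena-4967).
Given an asymptotically homogeneous isotropic product grid `z v = (s v₀, t v₁)` (`s i / i, t i / i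
→ a > 0` two-sidedly) on which the crude crossing event of bond-`ℤ²` at `p = ½` has Cardy limits
in EVERY conformal rectangle, the crude event on the standard embedding has Cardy limits in every
conformal rectangle. Proof (inclusion sandwich through Schoenflies square models, no percolation
estimate beyond self-duality): for `R` with square model `Φ`, (lower) a Hyp-crossing of the bulged
template `Q⁺_ε = Φ([-1+ε,1-ε]×[-1-ε,1+ε])` at mesh `δ√2/a`, read in standard positions (an `o(1)`
distortion, `exists_delta_norm_sub_le`), must cross `R.arc 0` and `R.arc 2` and so contains a crude
crossing of `R` at mesh `δ` (`exists_subchain_crossing`); (upper) a crude crossing of `R` and a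
DUAL Hyp-crossing of the conjugate template `Q†_ε` cannot coexist (`false_of_crossing_of_dualChain`:
plus position + primal/dual edge crossing), and the dual event has the Hyp probability by
self-duality; the Hyp limits `F(η(Q⁺_ε))`, `F(η(Q†_ε))` tend to `F(η(R))`, `F(1-η(R)) = 1 - F(η(R))`
as `ε → 0` (Radó continuity `tendsto_crossRatio_perturbQuad`, conjugate marking
`crossRatio_eq_one_sub_of_pt_eq_succ`, `cardyFunction_one_sub_holds`). The monotonicity
hypotheses on `s, t` are not needed. [folklore] -/
theorem renewalGridHarmless_proof :
    Summit.CriticalPhenomena.CardyFormulaZ2.Theses.CardyIKTransport.RenewalGridHarmless := by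
  intro a s t ha _ _ hsa hta H R φ x hφx
  obtain ⟨Φ, hΦ⟩ := exists_isSquareModel R
  have hη := ConformalRectangle.crossRatio_mem_Ioo_of_isUniformizing hφx
  have hFcont : ContinuousAt cardyFunction (crossRatio x) :=
    continuousOn_cardyFunction_Ioo.continuousAt (Ioo_mem_nhds hη.1 hη.2)
  obtain ⟨he0, he4, helim⟩ := bulgeSeq_facts
  have hx1 : ∀ n : ℕ, -1 + 1 / ((n : ℝ) + 4) < 1 - 1 / ((n : ℝ) + 4) := fun n => by
    linarith [he4 n]
  have hy1 : ∀ n : ℕ, -1 - 1 / ((n : ℝ) + 4) < 1 + 1 / ((n : ℝ) + 4) := fun n => by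
    linarith [he0 n]
  have hl₀ : Tendsto (fun n : ℕ => -1 + 1 / ((n : ℝ) + 4)) atTop (𝓝 (-1)) := by
    simpa using tendsto_const_nhds.add helim
  have hl₁ : Tendsto (fun n : ℕ => 1 - 1 / ((n : ℝ) + 4)) atTop (𝓝 1) := by
    simpa using tendsto_const_nhds.sub helim
  have hl₂ : Tendsto (fun n : ℕ => -1 - 1 / ((n : ℝ) + 4)) atTop (𝓝 (-1)) := by
    simpa using tendsto_const_nhds.sub helim
  have hl₃ : Tendsto (fun n : ℕ => 1 + 1 / ((n : ℝ) + 4)) atTop (𝓝 1) := by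
    simpa using tendsto_const_nhds.add helim
  rw [tendsto_order]
  constructor
  · -- lower bound through the bulged templates `Q⁺_{ε_n}`
    intro b hb
    set Q : ℕ → ConformalRectangle := fun n =>
      perturbQuad Φ (-1 + 1 / ((n : ℝ) + 4)) (1 - 1 / ((n : ℝ) + 4)) (-1 - 1 / ((n : ℝ) + 4))
        (1 + 1 / ((n : ℝ) + 4)) (hx1 n) (hy1 n) with hQ
    choose ψ y hψ using fun n => MarkedDomain.exists_isUniformizing_holds (Q n)
    obtain ⟨φ₀, x₀, hφ₀⟩ := MarkedDomain.exists_isUniformizing_holds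
      (perturbQuad Φ (-1) 1 (-1) 1 (by norm_num) (by norm_num))
    have hlim : Tendsto (fun n ↦ crossRatio (y n)) atTop (𝓝 (crossRatio x₀)) :=
      tendsto_crossRatio_perturbQuad Φ hx1 hy1 hl₀ hl₁ hl₂ hl₃ ψ y hψ φ₀ x₀ hφ₀
    have hx₀ : crossRatio x₀ = crossRatio x :=
      crossRatio_eq_of_carrier_eq_of_pt_eq (carrier_perturbQuad_one hΦ) (pt_perturbQuad_one hΦ)
        hφx hφ₀
    rw [hx₀] at hlim
    have hF : Tendsto (fun n ↦ cardyFunction (crossRatio (y n))) atTop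
        (𝓝 (cardyFunction (crossRatio x))) := hFcont.tendsto.comp hlim
    obtain ⟨n, hn⟩ := (hF.eventually (lt_mem_nhds hb)).exists
    -- Hyp for `Q n`, transported to the mesh `δ`
    have hHyp := (H (Q n) (ψ n) (y n) (hψ n)).eventually (lt_mem_nhds hn)
    have h2 := (tendsto_mesh_change ha).eventually hHyp
    obtain ⟨δ₀, hδ₀, hinc⟩ := exists_measureReal_hyp_le ha hsa hta hΦ (he0 n)
      ((he4 n).trans (by norm_num))
    have h3 : ∀ᶠ δ in 𝓝[>] (0 : ℝ), 0 < δ ∧ δ < δ₀ := by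
      filter_upwards [self_mem_nhdsWithin, mem_nhdsWithin_of_mem_nhds (Iio_mem_nhds hδ₀)]
        with δ h1 h2
      exact ⟨h1, h2⟩
    filter_upwards [h2, h3] with δ hδb hδ
    exact hδb.trans_le (hinc δ hδ.1 hδ.2)
  · -- upper bound through the conjugate bulged templates `Q†_{ε_n}`
    intro b hb
    set Ψ : ℂ ≃ₜ ℂ := (Homeomorph.mulLeft₀ I I_ne_zero).trans Φ with hΨ
    set Q : ℕ → ConformalRectangle := fun n =>
      perturbQuad Ψ (-1 + 1 / ((n : ℝ) + 4)) (1 - 1 / ((n : ℝ) + 4)) (-1 - 1 / ((n : ℝ) + 4))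
        (1 + 1 / ((n : ℝ) + 4)) (hx1 n) (hy1 n) with hQ
    choose ψ y hψ using fun n => MarkedDomain.exists_isUniformizing_holds (Q n)
    obtain ⟨φ₀, x₀, hφ₀⟩ := MarkedDomain.exists_isUniformizing_holds
      (perturbQuad Ψ (-1) 1 (-1) 1 (by norm_num) (by norm_num))
    have hlim : Tendsto (fun n ↦ crossRatio (y n)) atTop (𝓝 (crossRatio x₀)) :=
      tendsto_crossRatio_perturbQuad Ψ hx1 hy1 hl₀ hl₁ hl₂ hl₃ ψ y hψ φ₀ x₀ hφ₀
    have hx₀ : crossRatio x₀ = 1 - crossRatio x :=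
      crossRatio_eq_one_sub_of_pt_eq_succ (carrier_perturbQuad_rot_one hΦ)
        (pt_perturbQuad_rot_one hΦ) hφx hφ₀
    rw [hx₀] at hlim
    have hη' : 1 - crossRatio x ∈ Ioo (0 : ℝ) 1 := ⟨by linarith [hη.2], by linarith [hη.1]⟩
    have hFcont' : ContinuousAt cardyFunction (1 - crossRatio x) :=
      continuousOn_cardyFunction_Ioo.continuousAt (Ioo_mem_nhds hη'.1 hη'.2)
    have hF : Tendsto (fun n ↦ cardyFunction (crossRatio (y n))) atTop
        (𝓝 (cardyFunction (1 - crossRatio x))) := hFcont'.tendsto.comp hlim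
    rw [cardyFunction_one_sub_holds ⟨hη.1.le, hη.2.le⟩] at hF
    have hb' : 1 - b < 1 - cardyFunction (crossRatio x) := by linarith
    obtain ⟨n, hn⟩ := (hF.eventually (lt_mem_nhds hb')).exists
    have hHyp := (H (Q n) (ψ n) (y n) (hψ n)).eventually (lt_mem_nhds hn)
    have h2 := (tendsto_mesh_change ha).eventually hHyp
    obtain ⟨δ₀, hδ₀, hinc⟩ := exists_measureReal_std_le ha hsa hta hΦ (he0 n)
      ((he4 n).trans (by norm_num))
    have h3 : ∀ᶠ δ in 𝓝[>] (0 : ℝ), 0 < δ ∧ δ < δ₀ := by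
      filter_upwards [self_mem_nhdsWithin, mem_nhdsWithin_of_mem_nhds (Iio_mem_nhds hδ₀)]
        with δ h1 h2
      exact ⟨h1, h2⟩
    filter_upwards [h2, h3] with δ hδb hδ
    have := hinc δ hδ.1 hδ.2
    linarith

end Summit.CriticalPhenomena.CardyFormulaZ2.Theorems.CardyIKTransport.RenewalGridHarmless

end
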